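import Mathlib
import HarnessLib
import Literature.MathematicalPhysics.QuantumFieldTheory.ConstructiveQFTWave0
import Literature.MathematicalPhysics.QuantumLattice.AbelianFieldTensor
import Literature.MathematicalPhysics.QuantumLattice.AbelianMagneticFlux
import Summits.Ventures.LatticeQCDFlow.Scaling.FluxSectorCollar
import Summits.Ventures.LatticeQCDFlow.Scaling.FluxPatch
import Summits.Ventures.LatticeQCDFlow.Scaling.FluxTunnelling
import Summits.Ventures.LatticeQCDFlow.Scaling.SliceTwistWitness
import Summits.Ventures.LatticeQCDFlow.Scaling.BoxPeel
import Summits.Ventures.LatticeQCDFlow.Scaling.ThinPairs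
import Summits.Ventures.LatticeQCDFlow.Scaling.RowFields
import Summits.Ventures.LatticeQCDFlow.Scaling.BoxSpreadWitness
import Summits.Ventures.LatticeQCDFlow.Scaling.BoxTouch

/-!
# LatticeQCDFlow / Scaling — the balanced box spread: the flux threshold of an `l`-block is exactly `2 sin(π/(2(l-1)(l+3)))` (v3.6, (C7b″) sharp form, supplement)

HONEST FRAMING: exact (Metropolis-corrected) sampling algorithms for lattice gauge theory; figures
of merit are autocorrelation/cost numbers at stated couplings and volumes; no continuum-physics
claim.

THEORY-2.md §4 (C7(b″)), §5.17.  `U(1) = Circle`, `d = 2`, torus `(ℤ/L)²`, `2 ≤ l`; update set =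
the block `boxLinks 1 l` of `BoxPeel.lean`; `R_l = (l-1)(l+3)` = the number of plane positions whose
plaquette touches the block (`BoxSpreadWitness.lean`).

* **§1–§2 the balanced pair** (`2l + 2 ≤ L`).  The BOX BACKGROUND `B = rowField (boxRate l L)` has
  plaquette angle `-α_l/2` on the `l + 1` lines `{x 0 ≤ l}` and `+(l+1)α_l/(2(L-l-1)) ≤ α_l/2` on the
  others, flux charge `0`; the BALANCED BOX `A = B · boxSpread l` has angle `+α_l/2` on `R_l`, `B`'s
  angle elsewhere, flux charge `1` (`topCharge_mul`); both are `2 sin(α_l/4) = 2 sin(π/(2R_l))`-thin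
  and agree off the block.
* **§3 necessity, sharp.**  For `c > 2 sin(π/(2R_l))` and every `C`, the flux law
  `(μ ⊗ κ){Q ≠ Q'} ≤ C·μ{∃ p, dist(U_p,1) ≥ c}` fails for some `μ`-invariant Markov pair moving only
  the block (`not_fluxLaw_boxLinks_sharp`); so does the `ε`-sector law for `2 sin(π/(2R_l)) < ε ≤ 2`
  (`not_sectorLaw_boxLinks_sharp`).
* **§4 pinned.**  With the sufficiency side `fluxLaw_boxLinks_sharp` of `BoxTouch.lean` (every
  invariant measure, `(μ ⊗ κ){Q ≠ Q'} ≤ 2·μ{∃ p, dist(U_p,1) ≥ 2 sin(π/(2R_l))}`): THE ADMISSIBLE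
  FLUX THRESHOLD OF AN `l`-BLOCK IS EXACTLY `2 sin(π/(2(l-1)(l+3))) ≍ π/l²`
  (`fluxThreshold_boxLinks_pinned`) — quadratic, not linear, in the inverse block size, and not
  geometric (`BoxPeel.lean`).
-/

noncomputable section

namespace Summit.Ventures.LatticeQCDFlow.Theory2.Lattice.Flux

open MeasureTheory ProbabilityTheory Metric Set Filter Topology Real
open scoped ENNReal
open Literature.MathematicalPhysics.QuantumFieldTheory Literature.MathematicalPhysics.QuantumLattice

/-! ## §1. The background rates -/

section Rates

variable {l L : ℕ}

/-- Row rates of the BOX BACKGROUND: `-α_l/2` on the lines `v ≤ l`, `(l+1)α_l/(2(L-l-1))` on the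
others. [folklore] -/
def boxRate (l L : ℕ) (v : ℕ) : ℝ :=
  if v ≤ l then -(boxAlpha l / 2) else ((l : ℝ) + 1) * boxAlpha l / (2 * ((L : ℝ) - l - 1))

/-- On the lines `v ≤ l` the rate is `-α_l/2`. [folklore] -/
theorem boxRate_of_le {v : ℕ} (h : v ≤ l) : boxRate l L v = -(boxAlpha l / 2) := if_pos h

/-- On the lines `v > l` the rate is `(l+1)α_l/(2(L-l-1))`. [folklore] -/
theorem boxRate_of_lt {v : ℕ} (h : l < v) :
    boxRate l L v = ((l : ℝ) + 1) * boxAlpha l / (2 * ((L : ℝ) - l - 1)) := if_neg (by omega)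

/-- The background rates sum to zero over a period (`l + 2 ≤ L`). [folklore] -/
theorem sum_boxRate (hlL : l + 2 ≤ L) : ∑ v ∈ Finset.range L, boxRate l L v = 0 := by
  obtain ⟨m, rfl⟩ : ∃ m, L = (l + 1) + m := ⟨L - (l + 1), by omega⟩
  have hm : (m : ℝ) ≠ 0 := by exact_mod_cast (show m ≠ 0 by omega)
  have h1 : ∑ x ∈ Finset.range (l + 1), boxRate l (l + 1 + m) x =
      ∑ x ∈ Finset.range (l + 1), (-(boxAlpha l / 2)) :=
    Finset.sum_congr rfl fun x hx => boxRate_of_le (by rw [Finset.mem_range] at hx; omega)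
  have h2 : ∑ x ∈ Finset.range m, boxRate l (l + 1 + m) (l + 1 + x) = ∑ x ∈ Finset.range m,
      (((l : ℝ) + 1) * boxAlpha l / (2 * (((l + 1 + m : ℕ) : ℝ) - l - 1))) :=
    Finset.sum_congr rfl fun x _ => boxRate_of_lt (by omega)
  rw [Finset.sum_range_add, h1, h2, Finset.sum_const, Finset.card_range, nsmul_eq_mul,
    Finset.sum_const, Finset.card_range, nsmul_eq_mul]
  push_cast
  rw [show ((l : ℝ) + 1 + m - l - 1) = m by ring]
  field_simp
  ring

/-- `|boxRate| ≤ α_l/2` (`2l + 2 ≤ L`). [folklore] -/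
theorem abs_boxRate_le (hl : 2 ≤ l) (hlL : 2 * l + 2 ≤ L) (v : ℕ) : |boxRate l L v| ≤ boxAlpha l / 2 := by
  have hα := boxAlpha_pos hl
  have hL : ((l : ℝ) + 1) ≤ (L : ℝ) - l - 1 := by
    have : ((2 * l + 2 : ℕ) : ℝ) ≤ L := by exact_mod_cast hlL
    push_cast at this; linarith
  have hpos : 0 < (L : ℝ) - l - 1 := by
    have : (2 : ℝ) ≤ l := by exact_mod_cast hl
    linarith
  unfold boxRate
  split_ifs
  · rw [abs_neg, abs_of_pos (by positivity)]
  · rw [abs_of_nonneg (by positivity), div_le_div_iff₀ (by positivity) two_pos]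
    nlinarith

end Rates

/-! ## §2. The box background and the balanced box -/

section Balanced

variable {L : ℕ} [NeZero L] {l : ℕ}

/-- **The box background** `B = rowField (boxRate l L)` (charge `0`). [folklore] -/
def boxBackground (l L : ℕ) [NeZero L] : GaugeConfig 2 L Circle := rowField (boxRate l L)

/-- **The balanced box** `A = B · boxSpread l` (charge `1`). [folklore] -/
def balancedBox (l L : ℕ) [NeZero L] : GaugeConfig 2 L Circle := boxBackground l L * boxSpread l

/-- The plaquette angle of the balanced box. [folklore] -/
def balancedBoxF (l L a b : ℕ) : ℝ := boxRate l L a + boxF l a b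

omit [NeZero L] in
/-- `|balancedBoxF| ≤ α_l/2`: on `R_l` the spread's `α_l` meets the background's `-α_l/2`. [folklore] -/
theorem abs_balancedBoxF_le (hl : 2 ≤ l) (hlL : 2 * l + 2 ≤ L) (a b : ℕ) :
    |balancedBoxF l L a b| ≤ boxAlpha l / 2 := by
  unfold balancedBoxF boxF
  split_ifs with h
  · rw [boxRate_of_le h.1, abs_of_nonneg (by linarith [boxAlpha_pos hl])]; linarith
  · rw [add_zero]; exact abs_boxRate_le hl hlL a

/-- The plaquettes of the box background. [folklore] -/
theorem plaquetteHolonomy_boxBackground (hlL : l + 2 ≤ L) (x : Site 2 L) :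
    plaquetteHolonomy (boxBackground l L) x 0 1 = Circle.exp (boxRate l L (x 0).val) :=
  plaquetteHolonomy_rowField (by omega) (sum_boxRate hlL) x

/-- The plaquettes of the balanced box. [folklore] -/
theorem plaquetteHolonomy_balancedBox (hl : 2 ≤ l) (hlL : l + 2 ≤ L) (x : Site 2 L) :
    plaquetteHolonomy (balancedBox l L) x 0 1 = Circle.exp (balancedBoxF l L (x 0).val (x 1).val) := by
  rw [balancedBox, plaquetteHolonomy_mul', plaquetteHolonomy_boxBackground hlL,
    plaquetteHolonomy_boxSpread hl (by omega), ← Circle.exp_add, balancedBoxF]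

/-- Rates of size `≤ α_l/2 < π` lie in the principal branch. [folklore] -/
theorem mem_branch_of_abs_le_half (hl : 2 ≤ l) {r : ℝ} (h : |r| ≤ boxAlpha l / 2) : -π < r ∧ r ≤ π := by
  have := boxAlpha_lt_pi hl
  obtain ⟨h1, h2⟩ := abs_le.mp h
  exact ⟨by linarith, by linarith⟩

/-- The field tensor of the box background. [folklore] -/
theorem abelianFieldTensor_boxBackground (hl : 2 ≤ l) (hlL : 2 * l + 2 ≤ L) (x : Site 2 L) :
    abelianFieldTensor (boxBackground l L) x 0 1 = boxRate l L (x 0).val :=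
  abelianFieldTensor_eq_of_plaquette_eq_exp (plaquetteHolonomy_boxBackground (by omega) x)
    (mem_branch_of_abs_le_half hl (abs_boxRate_le hl hlL _)).1
    (mem_branch_of_abs_le_half hl (abs_boxRate_le hl hlL _)).2

/-- **The box background has flux charge `0`.** [folklore] -/
theorem topCharge_boxBackground (hl : 2 ≤ l) (hlL : 2 * l + 2 ≤ L) :
    topCharge (0 : Site 2 L) 0 1 (boxBackground l L) = 0 := by
  rw [topCharge_of_row (abelianFieldTensor_boxBackground hl hlL), sum_boxRate (by omega), mul_zero,
    zero_div]

/-- **The balanced box has flux charge `1`** (charges add: `0 + 1`). [folklore] -/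
theorem topCharge_balancedBox (hl : 2 ≤ l) (hlL : 2 * l + 2 ≤ L) :
    topCharge (0 : Site 2 L) 0 1 (balancedBox l L) = 1 := by
  rw [balancedBox, topCharge_mul (0 : Site 2 L) 0 1, topCharge_boxBackground hl hlL,
    topCharge_boxSpread hl (by omega), zero_add]
  intro x
  rw [abelianFieldTensor_boxBackground hl hlL, abelianFieldTensor_boxSpread hl (by omega)]
  exact mem_branch_of_abs_le_half hl (abs_balancedBoxF_le hl hlL _ _)

omit [NeZero L] in
/-- `α_l/2/2 = π/(2R_l)`. [folklore] -/
theorem boxAlpha_div_four (hl : 2 ≤ l) :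
    boxAlpha l / 2 / 2 = π / (2 * (((l : ℝ) - 1) * ((l : ℝ) + 3))) := by
  obtain ⟨h1, h3⟩ := boxDen_ne_zero hl
  unfold boxAlpha
  field_simp

/-- **The box background is `2 sin(π/(2R_l))`-thin.** [folklore] -/
theorem dist_plaquetteHolonomy_boxBackground_le (hl : 2 ≤ l) (hlL : 2 * l + 2 ≤ L) (p : Plaquette 2 L) :
    dist (plaquetteHolonomy (boxBackground l L) p.1 p.2.1.1 p.2.1.2) 1 ≤
      2 * Real.sin (π / (2 * (((l : ℝ) - 1) * ((l : ℝ) + 3)))) := by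
  have h := dist_plaquette_le_of_eq_exp (plaquetteHolonomy_boxBackground (l := l) (by omega))
    (fun x => abs_boxRate_le hl hlL (x 0).val) (by linarith [boxAlpha_lt_pi hl, boxAlpha_pos hl]) p
  rwa [boxAlpha_div_four hl] at h

/-- **The balanced box is `2 sin(π/(2R_l))`-thin.** [folklore] -/
theorem dist_plaquetteHolonomy_balancedBox_le (hl : 2 ≤ l) (hlL : 2 * l + 2 ≤ L) (p : Plaquette 2 L) :
    dist (plaquetteHolonomy (balancedBox l L) p.1 p.2.1.1 p.2.1.2) 1 ≤
      2 * Real.sin (π / (2 * (((l : ℝ) - 1) * ((l : ℝ) + 3)))) := by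
  have h := dist_plaquette_le_of_eq_exp (plaquetteHolonomy_balancedBox hl (by omega))
    (fun x => abs_balancedBoxF_le hl hlL (x 0).val (x 1).val)
    (by linarith [boxAlpha_lt_pi hl, boxAlpha_pos hl]) p
  rwa [boxAlpha_div_four hl] at h

/-- The background and the balanced box agree off the block. [folklore] -/
theorem boxBackground_eq_balancedBox_of_not_mem (hl : 2 ≤ l) (hlL : l + 1 ≤ L) {e : Edge 2 L}
    (he : e ∉ boxLinks (1 : Site 2 L) l) : boxBackground l L e = balancedBox l L e :=
  mul_apply_eq_of_eq_one _ _ (boxSpread_eq_one_of_not_mem hl hlL he)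

end Balanced

/-! ## §3. Necessity: no law on the block above `2 sin(π/(2R_l))` -/

section Necessity

variable {L : ℕ} [NeZero L] {l : ℕ}

/-- **NO FLUX LAW FOR AN `l`-BLOCK ABOVE `2 sin(π/(2(l-1)(l+3)))`** (`2 ≤ l`, `2l + 2 ≤ L`, any
`C`). [folklore] -/
theorem not_fluxLaw_boxLinks_sharp (hl : 2 ≤ l) (hlL : 2 * l + 2 ≤ L) {c : ℝ}
    (hc : 2 * Real.sin (π / (2 * (((l : ℝ) - 1) * ((l : ℝ) + 3)))) < c) (C : ℝ≥0∞) :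
    ¬ ∀ (μ : Measure (GaugeConfig 2 L Circle)) [IsProbabilityMeasure μ]
        (κ : Kernel (GaugeConfig 2 L Circle) (GaugeConfig 2 L Circle)) [IsMarkovKernel κ],
        κ.Invariant μ → (∀ᵐ q ∂(μ ⊗ₘ κ), ∀ e ∉ boxLinks (1 : Site 2 L) l, q.1 e = q.2 e) →
        (μ ⊗ₘ κ) {q | topCharge (0 : Site 2 L) 0 1 q.1 ≠ topCharge (0 : Site 2 L) 0 1 q.2} ≤
          C * μ {W | ∃ p : Plaquette 2 L,
            c ≤ dist (plaquetteHolonomy W p.1 p.2.1.1 p.2.1.2) 1} :=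
  not_fluxLaw_of_two (fun _ he => boxBackground_eq_balancedBox_of_not_mem hl (by omega) he)
    (not_mem_thick_of_thin fun p => (dist_plaquetteHolonomy_boxBackground_le hl hlL p).trans_lt hc)
    (not_mem_thick_of_thin fun p => (dist_plaquetteHolonomy_balancedBox_le hl hlL p).trans_lt hc)
    (by rw [topCharge_boxBackground hl hlL, topCharge_balancedBox hl hlL]; norm_num) C

/-- **NO `ε`-SECTOR LAW FOR AN `l`-BLOCK ABOVE `2 sin(π/(2(l-1)(l+3)))`**
(`2 sin(π/(2R_l)) < ε ≤ 2`, `c > 2 sin(π/(2R_l))`, any `C`). [folklore] -/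
theorem not_sectorLaw_boxLinks_sharp (hl : 2 ≤ l) (hlL : 2 * l + 2 ≤ L) {c ε : ℝ}
    (hc : 2 * Real.sin (π / (2 * (((l : ℝ) - 1) * ((l : ℝ) + 3)))) < c)
    (hε : 2 * Real.sin (π / (2 * (((l : ℝ) - 1) * ((l : ℝ) + 3)))) < ε) (hε2 : ε ≤ 2)
    (C : ℝ≥0∞) :
    ¬ ∀ (μ : Measure (GaugeConfig 2 L Circle)) [IsProbabilityMeasure μ]
        (κ : Kernel (GaugeConfig 2 L Circle) (GaugeConfig 2 L Circle)) [IsMarkovKernel κ],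
        κ.Invariant μ → (∀ᵐ q ∂(μ ⊗ₘ κ), ∀ e ∉ boxLinks (1 : Site 2 L) l, q.1 e = q.2 e) →
        (μ ⊗ₘ κ) {q | connectedComponentIn (Thin L ε) q.1 ≠
            connectedComponentIn (Thin L ε) q.2} ≤
          C * μ {W | ∃ p : Plaquette 2 L,
            c ≤ dist (plaquetteHolonomy W p.1 p.2.1.1 p.2.1.2) 1} :=
  not_sectorLaw_of_two (fun _ he => boxBackground_eq_balancedBox_of_not_mem hl (by omega) he)
    (not_mem_thick_of_thin fun p => (dist_plaquetteHolonomy_boxBackground_le hl hlL p).trans_lt hc)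
    (not_mem_thick_of_thin fun p => (dist_plaquetteHolonomy_balancedBox_le hl hlL p).trans_lt hc)
    (by rw [topCharge_boxBackground hl hlL, topCharge_balancedBox hl hlL]; norm_num)
    (fun p => (dist_plaquetteHolonomy_boxBackground_le hl hlL p).trans_lt hε)
    (fun p => (dist_plaquetteHolonomy_balancedBox_le hl hlL p).trans_lt hε) hε2 C

end Necessity

/-! ## §4. The block threshold, pinned -/

section Pinned

variable {L : ℕ} [NeZero L] {l : ℕ}

/-- **THE BLOCK THRESHOLD, PINNED** (summary, `2 ≤ l`, `2l + 2 ≤ L`): at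
`c⋆ = 2 sin(π/(2(l-1)(l+3)))` the flux law holds with constant `2` for every invariant pair moving
only the block, and for every `c > c⋆` no constant works. [folklore] -/
theorem fluxThreshold_boxLinks_pinned (hl : 2 ≤ l) (hlL : 2 * l + 2 ≤ L) :
    (∀ (μ : Measure (GaugeConfig 2 L Circle)) [IsProbabilityMeasure μ]
        (κ : Kernel (GaugeConfig 2 L Circle) (GaugeConfig 2 L Circle)) [IsMarkovKernel κ],
        κ.Invariant μ → (∀ᵐ q ∂(μ ⊗ₘ κ), ∀ e ∉ boxLinks (1 : Site 2 L) l, q.1 e = q.2 e) →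
        (μ ⊗ₘ κ) {q | topCharge (0 : Site 2 L) 0 1 q.1 ≠ topCharge (0 : Site 2 L) 0 1 q.2} ≤
          2 * μ {U | ∃ p : Plaquette 2 L, 2 * Real.sin (π / (2 * (((l : ℝ) - 1) * ((l : ℝ) + 3)))) ≤
            dist (plaquetteHolonomy U p.1 p.2.1.1 p.2.1.2) 1}) ∧
    ∀ c : ℝ, 2 * Real.sin (π / (2 * (((l : ℝ) - 1) * ((l : ℝ) + 3)))) < c → ∀ C : ℝ≥0∞,
      ¬ ∀ (μ : Measure (GaugeConfig 2 L Circle)) [IsProbabilityMeasure μ]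
          (κ : Kernel (GaugeConfig 2 L Circle) (GaugeConfig 2 L Circle)) [IsMarkovKernel κ],
          κ.Invariant μ → (∀ᵐ q ∂(μ ⊗ₘ κ), ∀ e ∉ boxLinks (1 : Site 2 L) l, q.1 e = q.2 e) →
          (μ ⊗ₘ κ) {q | topCharge (0 : Site 2 L) 0 1 q.1 ≠ topCharge (0 : Site 2 L) 0 1 q.2} ≤
            C * μ {W | ∃ p : Plaquette 2 L,
              c ≤ dist (plaquetteHolonomy W p.1 p.2.1.1 p.2.1.2) 1} :=
  ⟨fun μ _ κ _ hinv hloc => fluxLaw_boxLinks_sharp hl (by omega) μ κ hinv hloc,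
    fun _ hc C => not_fluxLaw_boxLinks_sharp hl hlL hc C⟩

end Pinned

end Summit.Ventures.LatticeQCDFlow.Theory2.Lattice.Flux
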